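import Literature.IUT.HodgeTheaters.PuncturedEllipticProLModelShadow
import HarnessLib

/-!
# An infinite pro-`l` model of [IUTchI] §1, part 11: the shadow in STANDARD POSITION — `F(Δ_X′) = Π_X`, `F⁻¹(Π_X̲) = Δ_X̲′`

Mochizuki, *Inter-universal Teichmüller theory I*, kurims manuscript (May 2020), §1 p. 37 ("`X̲ := C̲ ×_C X`", the
cyclic covering `X̲ → X` of degree `l`) ([IUTchI] §1 p.37) [claim: Mochizuki2012, status: disputed]; [AbsTopI] Lemma 4.5 (i)
p. 54 (`IsFreeProOn`) [cite: MochizukiAbsTopI2012, Lemma 4.5 (i) p.54].  (D-0012 claim key; series status DISPUTED —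
PROOF-ONLY module; nothing of the series is asserted, no side is taken on [IUTchIII] Cor. 3.12.)

Cell abc-iut, seat abc-iut-L5-d4, row R45 «COR12-MODL-LAWS-DERIVE@M_l», brick B3.  For a shadow homomorphism
`F : Δ_X′ → P` (part 9) of a datum `D′` with free basis `a, b` of `Δ_X′` and the standard values `F a = a`, `F b = (B_0)`:
* `topologicalClosure_closure_pair` — `⟨(B_0), a⟩⁻ = Π_X` in the model;
* **`shadow_mem_PiXm` / `PiXm_le_range_shadow`** — `F(Δ_X′) = Π_X` (dense generation on both sides; compact image);
* **`comap_shadow_eq_of_standardPosition`** — if `b ∈ Π_C̲′` (STANDARD POSITION (SP1)) and `Δ_X̲′ = Δ_X′ ∩ Π_C̲′` is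
  normal of index `l` in `Δ_X′`, then `F⁻¹(Π_X̲) = Δ_X̲′`: both are index-`l` normal subgroups of `Δ_X′` containing `b`
  and `a^l`, and `⟨a, b⟩` is dense — an index-`l` normal subgroup with these properties is UNIQUE (`[Δ_X′ : K₁ ∩ K₂] ≤ l`
  because every element is `a^i n`).
The Frattini comparison `Δ_X̲′/Φ_l ≅ Π_X̲/Φ_l(Π_X̲)` and the transfer of the `Δ_ε`-sentences are the sequel.
HONEST LABEL: derivation device over OUR interfaces; (A) and (SP1) are assumption labels; no `sorry`; symbolic prime `l`.
-/

noncomputable section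

namespace Literature.IUT.HodgeTheaters

namespace PuncturedEllipticData

namespace ProLModel

open DihedralGroup _root_.Topology Literature.AnabelianGeometry.AbsoluteAnabelian
open scoped Pointwise

universe u

variable (l : ℕ) [Fact l.Prime]

/-! ### `⟨(B_0), a⟩⁻ = Π_X` in the model -/

/-- A closed subgroup of `P` containing `a` contains all of `⟨a⟩ = ℤ_l` (`ℤ` is dense in `ℤ_l`).
[claim: Mochizuki2012, status: disputed] -/
theorem elA_mem_of_isClosed (L : Subgroup (P l)) (hL : IsClosed (L : Set (P l))) (ha : elA l 1 ∈ L) (s : ℤ_[l]) :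
    elA l s ∈ L := by
  let aHom : Multiplicative ℤ_[l] →* P l := SemidirectProduct.inr.comp SemidirectProduct.inl
  have haHom : Continuous aHom := (continuous_inl_inr_P l).2.comp
    (Literature.AnabelianGeometry.EtaleTheta.SettingModel.Semidirect.continuous_inl (isInducing_D l))
  let L' : AddSubgroup ℤ_[l] := (L.comap aHom).toAddSubgroup'
  have hL' : IsClosed (L' : Set ℤ_[l]) := hL.preimage haHom
  have h1 : (1 : ℤ_[l]) ∈ L' := ha
  have htop : L' = ⊤ := by
    rw [eq_top_iff]
    intro x _
    have hsub : Set.range (Int.cast : ℤ → ℤ_[l]) ⊆ (L' : Set ℤ_[l]) := by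
      rintro _ ⟨n, rfl⟩
      rw [SetLike.mem_coe, ← zsmul_one]
      exact L'.zsmul_mem h1 n
    have hx : x ∈ closure (Set.range (Int.cast : ℤ → ℤ_[l])) := by
      rw [PadicInt.denseRange_intCast.closure_range]; exact Set.mem_univ x
    exact hL'.closure_subset_iff.mpr hsub hx
  have hs : s ∈ L' := htop ▸ AddSubgroup.mem_top s
  exact hs

/-- **`⟨(B_0), a⟩⁻ = Π_X`**: the model's `Π_X = N ⋊ ⟨a⟩` is topologically generated by `B_0` and `a`.
([IUTchI] §1 p.37) [claim: Mochizuki2012, status: disputed] -/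
theorem topologicalClosure_closure_pair :
    (Subgroup.closure ({inN l (δ l 0), elA l 1} : Set (P l))).topologicalClosure = PiXm l := by
  classical
  set L := (Subgroup.closure ({inN l (δ l 0), elA l 1} : Set (P l))).topologicalClosure with hL
  have hLc : IsClosed (L : Set (P l)) := Subgroup.isClosed_topologicalClosure _
  have hB0 : inN l (δ l 0) ∈ L := Subgroup.le_topologicalClosure _ (Subgroup.subset_closure (Set.mem_insert _ _))
  have ha : elA l 1 ∈ L :=
    Subgroup.le_topologicalClosure _ (Subgroup.subset_closure (Set.mem_insert_of_mem _ (Set.mem_singleton _)))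
  have haAll : ∀ s : ℤ_[l], elA l s ∈ L := elA_mem_of_isClosed l L hLc ha
  have hBk : ∀ k : ZMod l, inN l (δ l k) ∈ L := fun k => by
    have hk : inN l (δ l k) = elA l ((k.val : ℕ) : ℤ_[l]) * inN l (δ l 0) * (elA l ((k.val : ℕ) : ℤ_[l]))⁻¹ := by
      rw [conj_inN, toDih_right_of_mem_PiXm l (elA_mem_PiXm l _), dact_r]
      change inN l (δ l k) = inN l (rot l (PadicInt.toZMod ((k.val : ℕ) : ℤ_[l])) (δ l 0))
      congr 1; funext m
      simp only [rot_apply, map_natCast, ZMod.natCast_zmod_val, δ_apply, sub_eq_zero]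
    rw [hk]
    exact L.mul_mem (L.mul_mem (haAll _) hB0) (L.inv_mem (haAll _))
  have hN : ∀ v : V l, inN l v ∈ L := fun v => by
    induction v using Pi.single_induction with
    | zero => rw [inN_zero]; exact L.one_mem
    | add f g hf hg => rw [inN_add]; exact L.mul_mem hf hg
    | single i t =>
      have : (Pi.single i t : V l) = t • δ l i := by
        funext m; simp only [Pi.smul_apply, δ_apply, Pi.single_apply, smul_eq_mul, mul_ite, mul_one, mul_zero]
      rw [this]; exact inN_smul_mem_of_isClosed l L hLc _ (hBk i) t
  refine le_antisymm ?_ fun g hg => ?_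
  · refine Subgroup.topologicalClosure_minimal _ ?_ ((PiXm l).isClosed_of_isOpen (isOpen_PiXm l))
    rw [Subgroup.closure_le]
    rintro x hx
    rcases hx with rfl | rfl
    · exact (Nhat_le l (inN_mem_Nhat l _)).1
    · exact elA_mem_PiXm l 1
  · rw [decomp_of_mem_PiXm l hg]
    exact L.mul_mem (hN _) (haAll _)

/-! ### `F(Δ_X′) = Π_X` -/

/-- **`F(Δ_X′) ⊆ Π_X`**: the closed subgroup `F⁻¹(Π_X)` contains the free generators, hence their dense span.
([IUTchI] §1 p.37) [claim: Mochizuki2012, status: disputed] -/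
theorem shadow_mem_PiXm {D' : PuncturedEllipticData.{u}} {gens : Fin 2 → ↥(D'.PiX ⊓ D'.DeltaC)}
    (hfree : IsFreeProOn ↥(D'.PiX ⊓ D'.DeltaC) Set.univ gens) (F : ↥(D'.PiX ⊓ D'.DeltaC) →* P l)
    (hF : Continuous F) (h0 : F (gens 0) = elA l 1) (h1 : F (gens 1) = inN l (δ l 0))
    (y : ↥(D'.PiX ⊓ D'.DeltaC)) : F y ∈ PiXm l := by
  classical
  haveI : CompactSpace ↥(D'.PiX ⊓ D'.DeltaC) :=
    isCompact_iff_compactSpace.mp D'.isClosed_piX_inf_deltaC.isCompact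
  have hK : IsClosed (((PiXm l).comap F : Subgroup _) : Set ↥(D'.PiX ⊓ D'.DeltaC)) :=
    ((PiXm l).isClosed_of_isOpen (isOpen_PiXm l)).preimage hF
  have hrange : (FreeGroup.lift gens).range ≤ (PiXm l).comap F := by
    refine FreeGroup.range_lift_le ?_
    rintro _ ⟨i, rfl⟩
    rw [SetLike.mem_coe, Subgroup.mem_comap]
    fin_cases i
    · change F (gens 0) ∈ PiXm l; rw [h0]; exact elA_mem_PiXm l 1
    · change F (gens 1) ∈ PiXm l; rw [h1]; exact (Nhat_le l (inN_mem_Nhat l _)).1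
  have hdense := hfree.dense_range_lift
  have hy : y ∈ closure (Set.range (FreeGroup.lift gens)) := by rw [hdense.closure_eq]; exact Set.mem_univ y
  have hsub : Set.range (FreeGroup.lift gens) ⊆ (((PiXm l).comap F : Subgroup _) : Set _) := fun z hz => by
    obtain ⟨w, rfl⟩ := hz; exact hrange ⟨w, rfl⟩
  exact hK.closure_subset_iff.mpr hsub hy

/-- **`Π_X ⊆ F(Δ_X′)`**: the compact image contains `a` and `B_0`, hence their closed span `Π_X`.
([IUTchI] §1 p.37) [claim: Mochizuki2012, status: disputed] -/
theorem PiXm_le_range_shadow {D' : PuncturedEllipticData.{u}} {gens : Fin 2 → ↥(D'.PiX ⊓ D'.DeltaC)}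
    (F : ↥(D'.PiX ⊓ D'.DeltaC) →* P l) (hF : Continuous F) (h0 : F (gens 0) = elA l 1)
    (h1 : F (gens 1) = inN l (δ l 0)) : PiXm l ≤ F.range := by
  classical
  haveI : CompactSpace ↥(D'.PiX ⊓ D'.DeltaC) :=
    isCompact_iff_compactSpace.mp D'.isClosed_piX_inf_deltaC.isCompact
  have hclosed : IsClosed ((F.range : Subgroup (P l)) : Set (P l)) := by
    rw [MonoidHom.coe_range]; exact (isCompact_range hF).isClosed
  rw [← topologicalClosure_closure_pair]
  refine Subgroup.topologicalClosure_minimal _ ?_ hclosed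
  rw [Subgroup.closure_le]
  rintro x hx
  rcases hx with rfl | rfl
  · exact ⟨gens 1, h1⟩
  · exact ⟨gens 0, h0⟩

/-- **`F(Δ_X′) = Π_X`.** ([IUTchI] §1 p.37) [claim: Mochizuki2012, status: disputed] -/
theorem range_shadow_eq {D' : PuncturedEllipticData.{u}} {gens : Fin 2 → ↥(D'.PiX ⊓ D'.DeltaC)}
    (hfree : IsFreeProOn ↥(D'.PiX ⊓ D'.DeltaC) Set.univ gens) (F : ↥(D'.PiX ⊓ D'.DeltaC) →* P l)
    (hF : Continuous F) (h0 : F (gens 0) = elA l 1) (h1 : F (gens 1) = inN l (δ l 0)) : F.range = PiXm l :=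
  le_antisymm (fun _ ⟨y, hy⟩ => hy ▸ shadow_mem_PiXm l hfree F hF h0 h1 y) (PiXm_le_range_shadow l F hF h0 h1)

/-! ### Standard position: `F⁻¹(Π_X̲) = Δ_X̲′` -/

/-- `Π_X̲` is normal in `Π_X` (model): conjugation by `Π_X` preserves the `⟨a⟩`-exponent mod `l`.
[claim: Mochizuki2012, status: disputed] -/
theorem conj_mem_PiXbar {x w : P l} (hx : x ∈ PiXm l) (hw : w ∈ PiXm l ⊓ PiCbarm l) :
    x * w * x⁻¹ ∈ PiXm l ⊓ PiCbarm l := by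
  obtain ⟨hw1, hw2⟩ := (mem_PiXbar_iff l w).1 hw
  have hwX : w ∈ PiXm l := hw.1
  have hxw : x * w ∈ PiXm l := Subgroup.mul_mem _ hx hwX
  refine (mem_PiXbar_iff l _).2 ⟨(mem_PiXm_iff l _).1 (Subgroup.mul_mem _ hxw (Subgroup.inv_mem _ hx)), ?_⟩
  have h3 := right_left_mul l (Subgroup.inv_mem _ hx) x
  rw [inv_mul_cancel, SemidirectProduct.one_right, SemidirectProduct.one_left] at h3
  have hinv : PadicInt.toZMod (Multiplicative.toAdd x⁻¹.right.left) = -PadicInt.toZMod (Multiplicative.toAdd x.right.left) := by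
    rw [eq_neg_iff_add_eq_zero, ← map_add, ← toAdd_mul, ← h3, toAdd_one, map_zero]
  rw [right_left_mul l hxw, right_left_mul l hx, toAdd_mul, toAdd_mul, map_add, map_add, hw2, hinv, add_zero,
    add_neg_cancel]

/-- The exponent-mod-`l` homomorphism on `Π_X`, pulled back along `F`: its kernel `F⁻¹(Π_X̲)` has index `l` in `Δ_X′`.
(Auxiliary: `[Π_X : Π_X̲] = l` in the model.) [claim: Mochizuki2012, status: disputed] -/
theorem index_comap_PiXbar_shadow {D' : PuncturedEllipticData.{u}} {gens : Fin 2 → ↥(D'.PiX ⊓ D'.DeltaC)}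
    (hfree : IsFreeProOn ↥(D'.PiX ⊓ D'.DeltaC) Set.univ gens) (F : ↥(D'.PiX ⊓ D'.DeltaC) →* P l)
    (hF : Continuous F) (h0 : F (gens 0) = elA l 1) (h1 : F (gens 1) = inN l (δ l 0)) :
    ((PiXm l ⊓ PiCbarm l).comap F).index = l := by
  classical
  haveI : Fact (1 < l) := ⟨(Fact.out : l.Prime).one_lt⟩
  -- the hom `Δ_X′ → ℤ/l`, `y ↦ (exponent of F y) mod l`
  let e : ↥(D'.PiX ⊓ D'.DeltaC) →* Multiplicative (ZMod l) := MonoidHom.mk'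
    (fun y => Multiplicative.ofAdd (PadicInt.toZMod (Multiplicative.toAdd (F y).right.left)))
    (fun y z => by
      rw [← ofAdd_add, map_mul, right_left_mul l (shadow_mem_PiXm l hfree F hF h0 h1 y), toAdd_mul, map_add])
  have hker : e.ker = (PiXm l ⊓ PiCbarm l).comap F := by
    ext y
    rw [MonoidHom.mem_ker, Subgroup.mem_comap, mem_PiXbar_iff]
    change Multiplicative.ofAdd (PadicInt.toZMod (Multiplicative.toAdd (F y).right.left)) = 1 ↔ _
    rw [← ofAdd_zero, Multiplicative.ofAdd.injective.eq_iff]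
    exact ⟨fun h => ⟨(mem_PiXm_iff l _).1 (shadow_mem_PiXm l hfree F hF h0 h1 y), h⟩, fun h => h.2⟩
  have hsurj : Function.Surjective e := by
    intro k
    refine ⟨gens 0 ^ (Multiplicative.toAdd k).val, ?_⟩
    rw [map_pow]
    change Multiplicative.ofAdd (PadicInt.toZMod (Multiplicative.toAdd (F (gens 0)).right.left)) ^ _ = k
    rw [h0]
    change Multiplicative.ofAdd (PadicInt.toZMod (Multiplicative.toAdd (Multiplicative.ofAdd (1 : ℤ_[l])))) ^ _ = k
    rw [toAdd_ofAdd, map_one, ← ofAdd_nsmul, nsmul_eq_mul, mul_one, ZMod.natCast_zmod_val, ofAdd_toAdd]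
  rw [← hker, Subgroup.index_ker, MonoidHom.range_eq_top.mpr hsurj, Subgroup.card_top, Nat.card_eq_fintype_card,
    Fintype.card_multiplicative, ZMod.card]

/-- **STANDARD POSITION ⇒ `F⁻¹(Π_X̲) = Δ_X̲′`.**  If `b ∈ Π_C̲′` (SP1) and `Δ_X̲′ ∩ Δ_X′` is normal of index `l` in
`Δ_X′`, then `F⁻¹(Π_X̲) = Δ_X̲′` (uniqueness of an index-`l` normal subgroup containing `b` and `a^l`, `⟨a,b⟩` dense).
([IUTchI] §1 p.37) [claim: Mochizuki2012, status: disputed] -/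
theorem comap_shadow_eq_of_standardPosition {D' : PuncturedEllipticData.{u}} {gens : Fin 2 → ↥(D'.PiX ⊓ D'.DeltaC)}
    (hfree : IsFreeProOn ↥(D'.PiX ⊓ D'.DeltaC) Set.univ gens) (F : ↥(D'.PiX ⊓ D'.DeltaC) →* P l)
    (hF : Continuous F) (h0 : F (gens 0) = elA l 1) (h1 : F (gens 1) = inN l (δ l 0))
    (hb : (gens 1 : D'.PiC) ∈ D'.PiCbar)
    (hN : ((D'.PiXbar ⊓ D'.DeltaC).subgroupOf (D'.PiX ⊓ D'.DeltaC)).Normal)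
    (hidx : ((D'.PiXbar ⊓ D'.DeltaC).subgroupOf (D'.PiX ⊓ D'.DeltaC)).index = l) :
    (PiXm l ⊓ PiCbarm l).comap F = (D'.PiXbar ⊓ D'.DeltaC).subgroupOf (D'.PiX ⊓ D'.DeltaC) := by
  classical
  haveI : Fact (1 < l) := ⟨(Fact.out : l.Prime).one_lt⟩
  haveI : NeZero l := ⟨(Fact.out : l.Prime).ne_zero⟩
  haveI := hN
  set K₁ : Subgroup ↥(D'.PiX ⊓ D'.DeltaC) := (PiXm l ⊓ PiCbarm l).comap F with hK₁
  set K₂ : Subgroup ↥(D'.PiX ⊓ D'.DeltaC) := (D'.PiXbar ⊓ D'.DeltaC).subgroupOf (D'.PiX ⊓ D'.DeltaC) with hK₂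
  -- `K₁` is normal of index `l`; both `K₁`, `K₂` contain `b = gens 1` and `a^l = (gens 0)^l`
  have hK₁idx : K₁.index = l := index_comap_PiXbar_shadow l hfree F hF h0 h1
  haveI hK₁N : K₁.Normal := ⟨fun n hn g => by
    rw [hK₁, Subgroup.mem_comap, map_mul, map_mul, map_inv]
    exact conj_mem_PiXbar l (shadow_mem_PiXm l hfree F hF h0 h1 g) hn⟩
  have hb₁ : gens 1 ∈ K₁ := by
    rw [hK₁, Subgroup.mem_comap, h1]; exact inN_mem_PiXbar l _
  have hb₂ : gens 1 ∈ K₂ := by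
    rw [hK₂, Subgroup.mem_subgroupOf]
    exact ⟨⟨(gens 1).2.1, hb⟩, (gens 1).2.2⟩
  have hal₁ : gens 0 ^ l ∈ K₁ := by rw [← hK₁idx]; exact Subgroup.pow_index_mem K₁ _
  have hal₂ : gens 0 ^ l ∈ K₂ := by rw [← hidx]; exact Subgroup.pow_index_mem K₂ _
  -- `N := K₁ ∩ K₂` is open normal; `M := ⟨a⟩ · N` is an open subgroup containing `a, b`, hence everything
  set N : Subgroup ↥(D'.PiX ⊓ D'.DeltaC) := K₁ ⊓ K₂ with hNdef
  haveI hNn : N.Normal := ⟨fun n hn g => ⟨hK₁N.conj_mem _ hn.1 g, hN.conj_mem _ hn.2 g⟩⟩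
  haveI : CompactSpace ↥(D'.PiX ⊓ D'.DeltaC) := isCompact_iff_compactSpace.mp D'.isClosed_piX_inf_deltaC.isCompact
  have hNopen : IsOpen (N : Set ↥(D'.PiX ⊓ D'.DeltaC)) := by
    have h1o : IsOpen (K₁ : Set ↥(D'.PiX ⊓ D'.DeltaC)) := ((isOpen_PiXm l).inter (isOpen_PiCbarm l)).preimage hF
    have h2o : IsOpen (K₂ : Set ↥(D'.PiX ⊓ D'.DeltaC)) := by
      have : (K₂ : Set ↥(D'.PiX ⊓ D'.DeltaC)) = Subtype.val ⁻¹' ((D'.PiXbar : Subgroup D'.PiC) : Set D'.PiC) := by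
        ext y
        simp only [SetLike.mem_coe, hK₂, Subgroup.mem_subgroupOf, Subgroup.mem_inf, Set.mem_preimage]
        exact ⟨fun h => h.1, fun h => ⟨h, y.2.2⟩⟩
      rw [this]
      exact (D'.isOpen_piX.inter D'.isOpen_piCbar).preimage continuous_subtype_val
    rw [hNdef, Subgroup.coe_inf]; exact h1o.inter h2o
  have hNidx : N.index ≠ 0 := by
    haveI : Finite (↥(D'.PiX ⊓ D'.DeltaC) ⧸ N) := Subgroup.quotient_finite_of_isOpen N hNopen
    haveI : N.FiniteIndex := Subgroup.finiteIndex_of_finite_quotient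
    exact Subgroup.FiniteIndex.index_ne_zero
  have halN : gens 0 ^ l ∈ N := ⟨hal₁, hal₂⟩
  have hbN : gens 1 ∈ N := ⟨hb₁, hb₂⟩
  set M : Subgroup ↥(D'.PiX ⊓ D'.DeltaC) := Subgroup.zpowers (gens 0) ⊔ N with hM
  have hMtop : M = ⊤ := by
    have hMo : IsOpen (M : Set ↥(D'.PiX ⊓ D'.DeltaC)) := Subgroup.isOpen_mono le_sup_right hNopen
    have hMc : IsClosed (M : Set ↥(D'.PiX ⊓ D'.DeltaC)) := M.isClosed_of_isOpen hMo
    have hgen : Set.range (FreeGroup.lift gens) ⊆ (M : Set ↥(D'.PiX ⊓ D'.DeltaC)) := by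
      rintro _ ⟨w, rfl⟩
      refine (FreeGroup.range_lift_le ?_ : (FreeGroup.lift gens).range ≤ M) ⟨w, rfl⟩
      rintro _ ⟨i, rfl⟩
      fin_cases i
      · exact Subgroup.mem_sup_left (Subgroup.mem_zpowers _)
      · exact Subgroup.mem_sup_right hbN
    rw [eq_top_iff]
    intro y _
    have hy : y ∈ closure (Set.range (FreeGroup.lift gens)) := by
      rw [hfree.dense_range_lift.closure_eq]; exact Set.mem_univ y
    exact hMc.closure_subset_iff.mpr hgen hy
  -- every coset of `N` is `a^k N`, `k < l`
  have hNle : N.index ≤ l := by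
    let t : ZMod l → ↥(D'.PiX ⊓ D'.DeltaC) ⧸ N := fun k => (((gens 0) ^ k.val : ↥(D'.PiX ⊓ D'.DeltaC)) : _ ⧸ N)
    have ht : Function.Surjective t := by
      intro q
      induction q using QuotientGroup.induction_on with
      | H g =>
        have hg : g ∈ M := hMtop ▸ Subgroup.mem_top g
        rw [hM, Subgroup.mem_sup_of_normal_right] at hg
        obtain ⟨y, hy, z, hz, rfl⟩ := hg
        obtain ⟨i, rfl⟩ := Subgroup.mem_zpowers_iff.mp hy
        refine ⟨(i : ZMod l), ?_⟩
        change (((gens 0) ^ ((i : ZMod l)).val : ↥(D'.PiX ⊓ D'.DeltaC)) : _ ⧸ N) = (((gens 0) ^ i * z : _) : _ ⧸ N)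
        rw [QuotientGroup.eq]
        -- `a^{-(i mod l)} · a^i ∈ N` since `l ∣ i − (i mod l)` and `a^l ∈ N`
        have hdvd : (l : ℤ) ∣ i - (((i : ZMod l)).val : ℤ) := by
          rw [← ZMod.intCast_eq_intCast_iff_dvd_sub]
          rw [Int.cast_natCast, ZMod.natCast_zmod_val]
        obtain ⟨m, hm⟩ := hdvd
        have hpow : ((gens 0) ^ ((i : ZMod l)).val)⁻¹ * ((gens 0) ^ i * z) =
            ((gens 0) ^ (l : ℤ)) ^ m * z := by
          rw [← mul_assoc, ← zpow_natCast, ← zpow_neg, ← zpow_add, ← zpow_mul]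
          congr 2
          linarith
        rw [hpow]
        refine N.mul_mem (Subgroup.zpow_mem _ ?_ _) hz
        rw [zpow_natCast]; exact halN
    have := Nat.card_le_card_of_surjective t ht
    rwa [Nat.card_zmod] at this
  -- conclude: `N = K₁ = K₂`
  have h1 : K₁ ≤ N := by
    have hmul := Subgroup.relIndex_mul_index (inf_le_left : N ≤ K₁)
    rw [hK₁idx] at hmul
    have hr : N.relIndex K₁ = 1 := by
      have hpos : 0 < N.relIndex K₁ := Nat.pos_of_ne_zero fun h => hNidx (by rw [← hmul, h, zero_mul])
      have hle : N.relIndex K₁ * l ≤ 1 * l := by rw [hmul, one_mul]; exact hNle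
      have := Nat.le_of_mul_le_mul_right hle (Fact.out : l.Prime).pos
      omega
    exact Subgroup.relIndex_eq_one.mp hr
  have h2 : K₂ ≤ N := by
    have hmul := Subgroup.relIndex_mul_index (inf_le_right : N ≤ K₂)
    rw [hidx] at hmul
    have hr : N.relIndex K₂ = 1 := by
      have hpos : 0 < N.relIndex K₂ := Nat.pos_of_ne_zero fun h => hNidx (by rw [← hmul, h, zero_mul])
      have hle : N.relIndex K₂ * l ≤ 1 * l := by rw [hmul, one_mul]; exact hNle
      have := Nat.le_of_mul_le_mul_right hle (Fact.out : l.Prime).pos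
      omega
    exact Subgroup.relIndex_eq_one.mp hr
  exact le_antisymm (h1.trans inf_le_right) (h2.trans inf_le_left)

end ProLModel

end PuncturedEllipticData

end Literature.IUT.HodgeTheaters
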